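import Mathlib.Analysis.SpecialFunctions.ImproperIntegrals
import Mathlib.Analysis.SpecialFunctions.Integrability.Basic
import Mathlib.MeasureTheory.Integral.IntervalIntegral.FundThmCalculus
import Literature.NumberTheory.Transcendental.IdealTetrahedronFubini
import HarnessLib

/-!
# The volume of the ideal tetrahedron `(∞, 0, 1, z)` — II: a one-dimensional integral

Topic `Literature/NumberTheory/Transcendental`. Second of three files proving the named fact
`BlochWigner_idealTetrahedronVolume` (`vol T(z) = D(z)`, Dupont 2001, (10.9), p. 96). Continuing
`IdealTetrahedronFubini.lean` (Tonelli; shear `x = 1 + ay/b - s`; scaling `y = bsu`), write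
`z = a + ib` with `b > 0`, `N = |z|²`, and

  `A(u) = 1 - 2au + uN`,  `B(u) = 1 - 2au + u²N = |1 - uz|²`,  `A(u) - B(u) = u(1-u)N`.

For the base point `p(s,u) = 1 + s(uz - 1)` (`s, u ∈ (0,1)`) the power with respect to the
circumcircle of `0, 1, z` is `s (A(u) - s B(u)) > 0` (`hemisphere_identity`), so the points of
`T(z)` over `p(s,u)` are exactly the `t > √(s(A(u) - sB(u)))` and (Milnor 1982, p. 19:
"`∫ dz/z³ = 1/(2h²)`")

* `base_param_eq` — `∫ t⁻³ dt` over the fibre `= 1 / (2 s (A(u) - s B(u)))`;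
* `inner_s_integral` — `∫₀¹ b ds / (2(A(u) - sB(u))) = (b / 2B(u)) · (log A(u) - log(A(u) - B(u)))`;
* `idealTetrahedronVolume_eq_integral` — **the volume as a single integral**

  `vol T(z) = ∫₀¹ (b / 2B(u)) · (log A(u) - log (A(u) - B(u))) du`     (`Im z > 0`),

  the integrand being nonnegative and integrable on `(0,1)` (logarithmic singularities at both
  ends: `log(A - B) = log u + log(1-u) + log N`).

This is Milnor's computation (Milnor 1982, Appendix, pp. 19–20) organised along the rays from the
vertex `1` instead of his decomposition by the circumcentre; the comparison with `D(z)` is in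
`BlochWignerDilogarithmIntegral.lean` and `BlochWignerDilogarithmProofs.lean`. Theorems only.

## References

* J. Milnor, *Hyperbolic geometry: the first 150 years*, Bull. AMS 6 (1982) 9–24, Appendix,
  proof of Lemma 2. [`Milnor1982`]
* J. L. Dupont, *Scissors congruences, group homology and characteristic classes* (2001),
  Ch. 10, (10.9), p. 96. [`Dupont2001`]
-/

noncomputable section

open MeasureTheory Set
open scoped ENNReal

namespace Literature.NumberTheory.Transcendental

namespace BlochWignerVolume

/-! ### The quadratic forms `A(u)` and `B(u)` -/

/-- `B(u) = |1 - u z|²`. [folklore] -/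
theorem tB_eq_normSq (z : ℂ) (u : ℝ) : (1 - 2 * z.re * u + u ^ 2 * Complex.normSq z) =
    Complex.normSq (1 - u * z) := by
  simp only [Complex.normSq_apply, Complex.sub_re, Complex.one_re, Complex.mul_re,
    Complex.ofReal_re, Complex.ofReal_im, Complex.sub_im, Complex.one_im, Complex.mul_im]
  ring

/-- `B(u) > 0` for `Im z > 0` (the line through `0` and `z` misses `1`). [folklore] -/
theorem tB_pos {z : ℂ} (hz : 0 < z.im) (u : ℝ) : 0 < (1 - 2 * z.re * u + u ^ 2 * Complex.normSq z)
    := by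
  rw [tB_eq_normSq, Complex.normSq_pos]
  intro h
  have := congrArg Complex.im h
  simp at this
  rcases this with h1 | h1
  · subst h1; simp at h
  · exact hz.ne' h1

/-- `|z|² > 0` for `Im z > 0`. [folklore] -/
theorem normSq_pos_of_im_pos {z : ℂ} (hz : 0 < z.im) : 0 < Complex.normSq z :=
  Complex.normSq_pos.2 (by rintro rfl; simp at hz)

/-- `A(u) - B(u) = u (1 - u) |z|²`. [folklore] -/
theorem tA_sub_tB (z : ℂ) (u : ℝ) : (1 - 2 * z.re * u + u * Complex.normSq z) - (1 - 2 * z.re * u +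
    u ^ 2 * Complex.normSq z) = u * (1 - u) * Complex.normSq z := by
  ring

/-- `A(u) = (1 - u) + u |1 - z|² > 0` on `[0, 1]`. [folklore] -/
theorem tA_pos {z : ℂ} (hz : 0 < z.im) {u : ℝ} (hu : u ∈ Icc (0 : ℝ) 1) : 0 < (1 - 2 * z.re * u + u
    * Complex.normSq z) := by
  have h1 : (1 - 2 * z.re * u + u * Complex.normSq z) = (1 - u) + u * Complex.normSq (1 - z) := by
    simp only [Complex.normSq_apply, Complex.sub_re, Complex.one_re, Complex.sub_im,
      Complex.one_im]
    ring
  have h2 : 0 < Complex.normSq (1 - z) := Complex.normSq_pos.2 (by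
    intro h; have := congrArg Complex.im h; simp at this; exact hz.ne' this)
  rw [h1]
  rcases eq_or_lt_of_le hu.1 with h | h
  · subst h; simp
  · have := mul_pos h h2
    nlinarith [hu.2]

/-- `A(u) - s B(u) > 0` for `s ∈ [0,1]`, `u ∈ (0,1)` (the point `p(s,u)` of the open triangle lies inside the
circumcircle). [folklore] -/
theorem tA_sub_mul_tB_pos {z : ℂ} (hz : 0 < z.im) {s u : ℝ} (hs : s ∈ Icc (0 : ℝ) 1)
    (hu : u ∈ Ioo (0 : ℝ) 1) : 0 < (1 - 2 * z.re * u + u * Complex.normSq z) - s * (1 - 2 * z.re *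
        u + u ^ 2 * Complex.normSq z) := by
  have hN : 0 < Complex.normSq z := normSq_pos_of_im_pos hz
  have h1 : (1 - 2 * z.re * u + u * Complex.normSq z) - s * (1 - 2 * z.re * u + u ^ 2 *
      Complex.normSq z) = u * (1 - u) * Complex.normSq z + (1 - s) * (1 - 2 * z.re * u + u ^ 2 *
      Complex.normSq z) := by
    ring
  rw [h1]
  have h2 : 0 < u * (1 - u) * Complex.normSq z := by
    have := mul_pos hu.1 (sub_pos.2 hu.2)
    positivity
  have h3 : 0 ≤ (1 - s) * (1 - 2 * z.re * u + u ^ 2 * Complex.normSq z) := mul_nonneg (sub_nonneg.2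
      hs.2) (tB_pos hz u).le
  linarith

/-! ### The `t`-integral -/

/-- `∫_{t > h} t⁻³ dt = 1 / (2h²)` (`h > 0`) (Milnor 1982, p. 19). [cite: Milnor1982, Appendix, proof of Lemma 2, p. 19] -/
theorem lintegral_Ioi_inv_cube {h : ℝ} (hh : 0 < h) :
    ∫⁻ t in Ioi h, ENNReal.ofReal (1 / t ^ 3) = ENNReal.ofReal (1 / (2 * h ^ 2)) := by
  have h1 : ∀ t ∈ Ioi h, ENNReal.ofReal (1 / t ^ 3) = ENNReal.ofReal (t ^ (-3 : ℝ)) := by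
    intro t ht
    have ht0 : 0 < t := hh.trans ht
    congr 1
    rw [Real.rpow_neg ht0.le, one_div, show (3 : ℝ) = ((3 : ℕ) : ℝ) by norm_num,
      Real.rpow_natCast]
  rw [setLIntegral_congr_fun measurableSet_Ioi h1,
    ← ofReal_integral_eq_lintegral_ofReal (integrableOn_Ioi_rpow_of_lt (by norm_num) hh)]
  · rw [integral_Ioi_rpow_of_lt (by norm_num) hh]
    congr 1
    rw [show (-3 : ℝ) + 1 = -2 by norm_num, Real.rpow_neg hh.le,
      show (2 : ℝ) = ((2 : ℕ) : ℝ) by norm_num, Real.rpow_natCast]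
    field_simp
  · exact ae_restrict_of_forall_mem measurableSet_Ioi
      (fun t ht => Real.rpow_nonneg (hh.le.trans (le_of_lt ht)) _)

/-- **The hemisphere over `p(s,u)`**: with `x = 1 - s + asu`, `y = bsu`,
`b(x² + y² + t² - x) + (a - N) y = b t² - b s (A(u) - s B(u))`, i.e. the power of `p(s,u)` with
respect to the circle through `0, 1, z` is `s (A(u) - s B(u))`. [folklore] -/
theorem hemisphere_identity (z : ℂ) (s u t : ℝ) :
    z.im * ((1 - s + z.re * s * u) ^ 2 + (z.im * s * u) ^ 2 + t ^ 2 - (1 - s + z.re * s * u)) +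
        (z.re - Complex.normSq z) * (z.im * s * u) =
      z.im * t ^ 2 - z.im * (s * ((1 - 2 * z.re * u + u * Complex.normSq z) - s * (1 - 2 * z.re * u
          + u ^ 2 * Complex.normSq z))) := by
  simp only [Complex.normSq_apply]
  ring

/-- **The fibre integral** (Milnor 1982, p. 19): over `p(s,u)`, `s, u ∈ (0,1)`, the points of `T(z)`
are the `t > √(s(A - sB))`, and `∫ t⁻³ dt = 1 / (2 s (A(u) - s B(u)))`.
[cite: Milnor1982, Appendix, proof of Lemma 2, p. 19] -/
theorem base_param_eq {z : ℂ} (hz : 0 < z.im) {s u : ℝ} (hs : s ∈ Ioo (0 : ℝ) 1)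
    (hu : u ∈ Ioo (0 : ℝ) 1) :
    ∫⁻ t, (idealTetrahedron z).indicator (fun p => ENNReal.ofReal (1 / p 2 ^ 3)) ![1 - s + z.re * s
        * u, z.im * s * u, t] =
      ENNReal.ofReal (1 / (2 * (s * ((1 - 2 * z.re * u + u * Complex.normSq z) - s * (1 - 2 * z.re
          * u + u ^ 2 * Complex.normSq z))))) := by
  set c := s * ((1 - 2 * z.re * u + u * Complex.normSq z) - s * (1 - 2 * z.re * u + u ^ 2 *
      Complex.normSq z)) with hc_def
  have hc : 0 < c := mul_pos hs.1 (tA_sub_mul_tB_pos hz ⟨hs.1.le, hs.2.le⟩ hu)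
  have hfun : ∀ t, (idealTetrahedron z).indicator (fun p => ENNReal.ofReal (1 / p 2 ^ 3)) ![1 - s +
      z.re * s * u, z.im * s * u, t] =
      (Ioi (Real.sqrt c)).indicator (fun t => ENNReal.ofReal (1 / t ^ 3)) t := by
    intro t
    rw [indicator_vec_eq_ite]
    by_cases ht : Real.sqrt c < t
    · have ht0 : 0 < t := (Real.sqrt_nonneg c).trans_lt ht
      have ht2 : c < t ^ 2 := (Real.sqrt_lt' ht0).1 ht
      rw [Set.indicator_of_mem (show t ∈ Ioi (Real.sqrt c) from ht), if_pos]
      refine ⟨mul_pos (mul_pos hz hs.1) hu.1, ?_, ?_, ht0, ?_⟩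
      · nlinarith [hs.2]
      · have : z.im * s * u < z.im * s := by nlinarith [mul_pos hz hs.1, hu.2]
        nlinarith
      · rw [hemisphere_identity]
        nlinarith
    · rw [Set.indicator_of_notMem (show t ∉ Ioi (Real.sqrt c) from ht), if_neg]
      rintro ⟨-, -, -, h4, h5⟩
      apply ht
      rw [hemisphere_identity] at h5
      have : c < t ^ 2 := by nlinarith
      exact (Real.sqrt_lt' h4).2 this
  simp_rw [hfun]
  rw [lintegral_indicator measurableSet_Ioi, lintegral_Ioi_inv_cube (Real.sqrt_pos.2 hc),
    Real.sq_sqrt hc.le]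

/-- For `s ∈ (0,1)`: the `y`-integral after shear and scaling, with the fibre integral evaluated:
`∫ dy (∫ t⁻³ dt) = ∫₀¹ b du / (2 (A(u) - s B(u)))`. [folklore] -/
theorem base_shear_eq {z : ℂ} (hz : 0 < z.im) {s : ℝ} (hs : s ∈ Ioo (0 : ℝ) 1) :
    ∫⁻ y : ℝ, ∫⁻ t, (idealTetrahedron z).indicator (fun p => ENNReal.ofReal (1 / p 2 ^ 3)) ![1 +
        z.re * y / z.im - s, y, t] =
      ∫⁻ u in Ioo (0 : ℝ) 1, ENNReal.ofReal (z.im / (2 * ((1 - 2 * z.re * u + u * Complex.normSq z)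
          - s * (1 - 2 * z.re * u + u ^ 2 * Complex.normSq z)))) := by
  rw [base_shear_scale hz hs]
  rw [← setLIntegral_eq_of_support_subset (s := Ioo (0 : ℝ) 1)]
  · rw [← lintegral_const_mul' _ _ ENNReal.ofReal_ne_top]
    refine setLIntegral_congr_fun measurableSet_Ioo fun u hu => ?_
    rw [base_param_eq hz hs hu, ← ENNReal.ofReal_mul (mul_pos hz hs.1).le]
    congr 1
    have h1 : (1 - 2 * z.re * u + u * Complex.normSq z) - s * (1 - 2 * z.re * u + u ^ 2 *
        Complex.normSq z) ≠ 0 := (tA_sub_mul_tB_pos hz ⟨hs.1.le, hs.2.le⟩ hu).ne'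
    have hs0 : s ≠ 0 := hs.1.ne'
    field_simp
  · intro u hu
    by_contra h
    apply hu
    simp_rw [indicator_param_eq_zero hz hs h]
    simp

/-! ### The `s`-integral and the one-dimensional formula -/

/-- `∫₀¹ b ds / (2(A - sB)) = (b / 2B) (log A - log (A - B))` (`u ∈ (0,1)`). [folklore] -/
theorem inner_s_integral {z : ℂ} (hz : 0 < z.im) {u : ℝ} (hu : u ∈ Ioo (0 : ℝ) 1) :
    ∫⁻ s in Ioo (0 : ℝ) 1, ENNReal.ofReal (z.im / (2 * ((1 - 2 * z.re * u + u * Complex.normSq z) -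
        s * (1 - 2 * z.re * u + u ^ 2 * Complex.normSq z)))) =
      ENNReal.ofReal (z.im / (2 * (1 - 2 * z.re * u + u ^ 2 * Complex.normSq z)) * (Real.log (1 - 2
          * z.re * u + u * Complex.normSq z) - Real.log ((1 - 2 * z.re * u + u * Complex.normSq z)
          - (1 - 2 * z.re * u + u ^ 2 * Complex.normSq z)))) := by
  have hB : 0 < (1 - 2 * z.re * u + u ^ 2 * Complex.normSq z) := tB_pos hz u
  have hpos : ∀ s ∈ Icc (0 : ℝ) 1, 0 < (1 - 2 * z.re * u + u * Complex.normSq z) - s * (1 - 2 *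
      z.re * u + u ^ 2 * Complex.normSq z) :=
    fun s hs => tA_sub_mul_tB_pos hz hs hu
  have hcont : ContinuousOn (fun s : ℝ => z.im / (2 * ((1 - 2 * z.re * u + u * Complex.normSq z) -
      s * (1 - 2 * z.re * u + u ^ 2 * Complex.normSq z)))) (Icc 0 1) := by
    refine ContinuousOn.div continuousOn_const (by fun_prop) fun s hs => ?_
    exact mul_ne_zero two_ne_zero (hpos s hs).ne'
  rw [← ofReal_integral_eq_lintegral_ofReal]
  · congr 1
    rw [← integral_Ioc_eq_integral_Ioo, ← intervalIntegral.integral_of_le zero_le_one]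
    have hderiv : ∀ s ∈ Set.uIcc (0 : ℝ) 1,
        HasDerivAt (fun s : ℝ => -(z.im / (2 * (1 - 2 * z.re * u + u ^ 2 * Complex.normSq z))) *
            Real.log ((1 - 2 * z.re * u + u * Complex.normSq z) - s * (1 - 2 * z.re * u + u ^ 2 *
            Complex.normSq z)))
          (z.im / (2 * ((1 - 2 * z.re * u + u * Complex.normSq z) - s * (1 - 2 * z.re * u + u ^ 2 *
              Complex.normSq z)))) s := by
      intro s hs
      rw [Set.uIcc_of_le zero_le_one] at hs
      have h1 : HasDerivAt (fun s : ℝ => (1 - 2 * z.re * u + u * Complex.normSq z) - s * (1 - 2 *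
          z.re * u + u ^ 2 * Complex.normSq z)) (-(1 - 2 * z.re * u + u ^ 2 * Complex.normSq z)) s
          := by
        simpa only [id_eq, one_mul] using ((hasDerivAt_id s).mul_const
          (1 - 2 * z.re * u + u ^ 2 * Complex.normSq z)).const_sub
            (1 - 2 * z.re * u + u * Complex.normSq z)
      have h2 := (Real.hasDerivAt_log (hpos s hs).ne').comp s h1
      have h3 := h2.const_mul (-(z.im / (2 * (1 - 2 * z.re * u + u ^ 2 * Complex.normSq z))))
      refine h3.congr_deriv ?_
      have hB0 : (1 - 2 * z.re * u + u ^ 2 * Complex.normSq z) ≠ 0 := hB.ne'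
      have hp0 : (1 - 2 * z.re * u + u * Complex.normSq z) - s * (1 - 2 * z.re * u + u ^ 2 *
          Complex.normSq z) ≠ 0 := (hpos s hs).ne'
      field_simp
    rw [intervalIntegral.integral_eq_sub_of_hasDerivAt hderiv
      (hcont.intervalIntegrable_of_Icc zero_le_one)]
    simp only [one_mul, zero_mul, sub_zero]
    ring
  · exact (hcont.integrableOn_Icc).mono_set Ioo_subset_Icc_self
  · exact ae_restrict_of_forall_mem measurableSet_Ioo fun s hs =>
      (div_pos hz (mul_pos two_pos (hpos s ⟨hs.1.le, hs.2.le⟩))).le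

/-- Measurability of `(s, u) ↦ b / (2(A(u) - s B(u)))` (for the Tonelli swap). [folklore] -/
theorem measurable_volKernel (z : ℂ) :
    Measurable (fun p : ℝ × ℝ =>
      ENNReal.ofReal (z.im / (2 * ((1 - 2 * z.re * p.2 + p.2 * Complex.normSq z) - p.1 * (1 - 2 *
          z.re * p.2 + p.2 ^ 2 * Complex.normSq z))))) := by
  fun_prop

/-- **`vol T(z)` as a one-dimensional Lebesgue integral**:
`∫⁻_{T(z)} t⁻³ = ∫⁻_{(0,1)} (b/2B)(log A - log(A - B))`. [cite: Milnor1982, Appendix, proof of Lemma 2, pp. 19–20] -/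
theorem lintegral_idealTetrahedron_eq {z : ℂ} (hz : 0 < z.im) :
    ∫⁻ p in idealTetrahedron z, ENNReal.ofReal (1 / p 2 ^ 3) =
      ∫⁻ u in Ioo (0:ℝ) 1, ENNReal.ofReal (z.im / (2 * (1 - 2 * z.re * u + u ^ 2 * Complex.normSq
          z)) * (Real.log (1 - 2 * z.re * u + u * Complex.normSq z) - Real.log ((1 - 2 * z.re * u +
          u * Complex.normSq z) - (1 - 2 * z.re * u + u ^ 2 * Complex.normSq z)))) := by
  rw [lintegral_idealTetrahedron_eq_iterated, iterated_shear, iterated_shear_restrict hz,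
    setLIntegral_congr_fun measurableSet_Ioo (fun s hs => base_shear_eq hz hs)]
  have hm : AEMeasurable (Function.uncurry fun s u : ℝ =>
      ENNReal.ofReal (z.im / (2 * ((1 - 2 * z.re * u + u * Complex.normSq z) - s * (1 - 2 * z.re *
          u + u ^ 2 * Complex.normSq z)))))
      ((volume.restrict (Ioo (0:ℝ) 1)).prod (volume.restrict (Ioo (0:ℝ) 1))) :=
    (measurable_volKernel z).aemeasurable
  rw [lintegral_lintegral_swap hm]
  exact setLIntegral_congr_fun measurableSet_Ioo (fun u hu => inner_s_integral hz hu)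

/-! ### Integrability of the one-dimensional integrand and the Bochner form -/

/-- On `(0,1)`: `log (A - B) = log u + log (1 - u) + log |z|²`. [folklore] -/
theorem log_tA_sub_tB {z : ℂ} (hz : 0 < z.im) {u : ℝ} (hu : u ∈ Ioo (0:ℝ) 1) :
    Real.log ((1 - 2 * z.re * u + u * Complex.normSq z) - (1 - 2 * z.re * u + u ^ 2 *
        Complex.normSq z)) = Real.log u + Real.log (1 - u) + Real.log (Complex.normSq z) := by
  rw [tA_sub_tB, Real.log_mul (mul_pos hu.1 (sub_pos.2 hu.2)).ne' (normSq_pos_of_im_pos hz).ne',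
    Real.log_mul hu.1.ne' (sub_pos.2 hu.2).ne']

/-- The volume integrand split into its three logarithmic pieces (on `(0,1)`). [folklore] -/
theorem volIntegrand_eq {z : ℂ} (hz : 0 < z.im) {u : ℝ} (hu : u ∈ Ioo (0:ℝ) 1) :
    z.im / (2 * (1 - 2 * z.re * u + u ^ 2 * Complex.normSq z)) * (Real.log (1 - 2 * z.re * u + u *
        Complex.normSq z) - Real.log ((1 - 2 * z.re * u + u * Complex.normSq z) - (1 - 2 * z.re * u
        + u ^ 2 * Complex.normSq z))) =
      z.im / (2 * (1 - 2 * z.re * u + u ^ 2 * Complex.normSq z)) * (Real.log (1 - 2 * z.re * u + u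
          * Complex.normSq z) - Real.log (Complex.normSq z)) -
      z.im / (2 * (1 - 2 * z.re * u + u ^ 2 * Complex.normSq z)) * Real.log u - z.im / (2 * (1 - 2
          * z.re * u + u ^ 2 * Complex.normSq z)) * Real.log (1 - u) := by
  rw [log_tA_sub_tB hz hu]; ring

/-- The coefficient `b / 2B(u)` is continuous on `[0,1]`. [folklore] -/
theorem continuousOn_coeff {z : ℂ} (hz : 0 < z.im) :
    ContinuousOn (fun u : ℝ => z.im / (2 * (1 - 2 * z.re * u + u ^ 2 * Complex.normSq z)))
        (Set.uIcc (0:ℝ) 1) :=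
  (continuousOn_const.div (by fun_prop) fun u _ => mul_ne_zero two_ne_zero (tB_pos hz u).ne')

/-- Piece 1, `(b/2B)(log A - log N)`, is continuous on `[0,1]`, hence integrable. [folklore] -/
theorem intervalIntegrable_piece1 {z : ℂ} (hz : 0 < z.im) :
    IntervalIntegrable (fun u : ℝ => z.im / (2 * (1 - 2 * z.re * u + u ^ 2 * Complex.normSq z)) *
      (Real.log (1 - 2 * z.re * u + u * Complex.normSq z) - Real.log (Complex.normSq z))) volume 0
          1 := by
  refine ContinuousOn.intervalIntegrable ?_
  refine (continuousOn_coeff hz).mul (ContinuousOn.sub ?_ continuousOn_const)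
  refine ContinuousOn.log (by fun_prop) fun u hu => ?_
  rw [Set.uIcc_of_le zero_le_one] at hu
  exact (tA_pos hz hu).ne'

/-- Piece 2, `(b/2B) log u`, is integrable on `[0,1]` (`log` is). [folklore] -/
theorem intervalIntegrable_piece2 {z : ℂ} (hz : 0 < z.im) :
    IntervalIntegrable (fun u : ℝ => z.im / (2 * (1 - 2 * z.re * u + u ^ 2 * Complex.normSq z)) *
        Real.log u) volume 0 1 :=
  intervalIntegral.intervalIntegrable_log'.continuousOn_mul (continuousOn_coeff hz)

/-- `log (1 - u)` is integrable on `[0,1]`. [folklore] -/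
theorem intervalIntegrable_log_one_sub :
    IntervalIntegrable (fun u : ℝ => Real.log (1 - u)) volume 0 1 := by
  simpa using (intervalIntegral.intervalIntegrable_log' (a := 1) (b := 0)).comp_sub_left 1

/-- Piece 3, `(b/2B) log (1 - u)`, is integrable on `[0,1]`. [folklore] -/
theorem intervalIntegrable_piece3 {z : ℂ} (hz : 0 < z.im) :
    IntervalIntegrable (fun u : ℝ => z.im / (2 * (1 - 2 * z.re * u + u ^ 2 * Complex.normSq z)) *
        Real.log (1 - u)) volume 0 1 :=
  intervalIntegrable_log_one_sub.continuousOn_mul (continuousOn_coeff hz)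

/-- The volume integrand is integrable on `(0,1)`. [folklore] -/
theorem integrableOn_volIntegrand {z : ℂ} (hz : 0 < z.im) :
    IntegrableOn (fun u : ℝ => z.im / (2 * (1 - 2 * z.re * u + u ^ 2 * Complex.normSq z)) *
        (Real.log (1 - 2 * z.re * u + u * Complex.normSq z) - Real.log ((1 - 2 * z.re * u + u *
        Complex.normSq z) - (1 - 2 * z.re * u + u ^ 2 * Complex.normSq z)))) (Ioo (0:ℝ) 1) := by
  have h := ((intervalIntegrable_piece1 hz).sub (intervalIntegrable_piece2 hz)).sub
    (intervalIntegrable_piece3 hz)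
  rw [intervalIntegrable_iff_integrableOn_Ioo_of_le zero_le_one] at h
  refine h.congr_fun (fun u hu => ?_) measurableSet_Ioo
  simp only [volIntegrand_eq hz hu]

/-- The volume integrand is interval-integrable on `[0,1]`. [folklore] -/
theorem intervalIntegrable_volIntegrand {z : ℂ} (hz : 0 < z.im) :
    IntervalIntegrable (fun u : ℝ => z.im / (2 * (1 - 2 * z.re * u + u ^ 2 * Complex.normSq z)) *
        (Real.log (1 - 2 * z.re * u + u * Complex.normSq z) - Real.log ((1 - 2 * z.re * u + u *
        Complex.normSq z) - (1 - 2 * z.re * u + u ^ 2 * Complex.normSq z)))) volume 0 1 := by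
  rw [intervalIntegrable_iff_integrableOn_Ioo_of_le zero_le_one]
  exact integrableOn_volIntegrand hz

/-- The volume integrand is nonnegative on `(0,1)` (`A ≥ A - B > 0`, `B > 0`). [folklore] -/
theorem volIntegrand_nonneg {z : ℂ} (hz : 0 < z.im) {u : ℝ} (hu : u ∈ Ioo (0:ℝ) 1) :
    0 ≤ z.im / (2 * (1 - 2 * z.re * u + u ^ 2 * Complex.normSq z)) * (Real.log (1 - 2 * z.re * u +
        u * Complex.normSq z) - Real.log ((1 - 2 * z.re * u + u * Complex.normSq z) - (1 - 2 * z.re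
        * u + u ^ 2 * Complex.normSq z))) := by
  have hB := tB_pos hz u
  have hAB : 0 < (1 - 2 * z.re * u + u * Complex.normSq z) - (1 - 2 * z.re * u + u ^ 2 *
      Complex.normSq z) := by
    simpa using tA_sub_mul_tB_pos hz ⟨zero_le_one, le_rfl⟩ hu
  refine mul_nonneg (div_pos hz (by positivity)).le (sub_nonneg.2 ?_)
  exact Real.log_le_log hAB (by linarith)

/-- **The volume of the ideal tetrahedron `(∞, 0, 1, z)` as a one-dimensional integral**
(Milnor 1982, Appendix, proof of Lemma 2, organised along the rays from the vertex `1`): for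
`Im z > 0`,
`vol T(z) = ∫₀¹ (b / 2B(u)) (log A(u) - log (A(u) - B(u))) du`,
`A(u) = 1 - 2au + u|z|²`, `B(u) = |1 - uz|²`. [cite: Milnor1982, Appendix, proof of Lemma 2, pp. 19–20] -/
theorem idealTetrahedronVolume_eq_integral {z : ℂ} (hz : 0 < z.im) :
    idealTetrahedronVolume z = ∫ u in (0:ℝ)..1, z.im / (2 * (1 - 2 * z.re * u + u ^ 2 *
        Complex.normSq z)) * (Real.log (1 - 2 * z.re * u + u * Complex.normSq z) - Real.log ((1 - 2
        * z.re * u + u * Complex.normSq z) - (1 - 2 * z.re * u + u ^ 2 * Complex.normSq z))) := by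
  rw [idealTetrahedronVolume, integral_eq_lintegral_of_nonneg_ae, lintegral_idealTetrahedron_eq hz,
    ← ofReal_integral_eq_lintegral_ofReal (integrableOn_volIntegrand hz), ENNReal.toReal_ofReal,
    intervalIntegral.integral_of_le zero_le_one, integral_Ioc_eq_integral_Ioo]
  · exact setIntegral_nonneg measurableSet_Ioo fun u hu => volIntegrand_nonneg hz hu
  · exact ae_restrict_of_forall_mem measurableSet_Ioo fun u hu => volIntegrand_nonneg hz hu
  · exact ae_restrict_of_forall_mem (measurableSet_idealTetrahedron z) fun p hp => by
      have := pos_of_mem_idealTetrahedron hp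
      positivity
  · exact (by fun_prop : Measurable fun p : Fin 3 → ℝ => 1 / p 2 ^ 3).aestronglyMeasurable

end BlochWignerVolume

end Literature.NumberTheory.Transcendental
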